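import Summits.CriticalPhenomena.PercolationContinuityZ3.Theorems.PercNearOneGluingNoHeavyQuantRootReductionCompanionCert
import Summits.CriticalPhenomena.PercolationContinuityZ3.Theorems.PercNearOneGluingNoHeavyQuantRootDecGradedMerge
import HarnessLib

/-!
# QUANT lane R8, FAR on general trees — THE CERTIFICATE MENU of the root reduction in ONE theorem:
# per genuine term β | α | γ (DIB) | γ‴ (gap check) | γ⁗ (companion cloud) | γ⁗₁ (companion, one light) | matching | μ (graded merge) | ε (Cantelli)

builds on p205010 (kernel theorem, internal audit signed; external expert review pending)

Support file (`--supports stmt-CriticalPhenomena-4575`), QUANT lane typer seat prim-quant-stmt (gen 18), rung R8 of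
`run/shared/lean/prim/quant/LADDER.md`.  Asked for by prim-quant-p1 g11 (lane INBOX 07:36Z: "@typer: please add μ to the disjunction
of `rtail_ge_of_decCert`") and the gen-16 lead (N30 (7)(a): γ‴/γ⁗ as certificate rules for R3).  `RootDec.rtail_ge_of_decCert` (R3,
`…QuantDIBStar`, typer g17) is landed and append-only, so the enlarged disjunction is a NEW theorem here; R3, `rtail_ge_of_gapCerts`
(`…QuantRootReductionGapCert`) and this menu all feed R1 (`rtail_ge_of_terms`).  Theorems only (local notation copied verbatim from
`…QuantRootReduction`), no sorries, standard axioms.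

THE MENU (`Quant.RootDec.rtail_ge_of_certMenu`).  Structure laws `μ k = Σ_r λ k r · TP[lo k r, hi k r, g k r]` (the hypothesis block
of R1; produced from bare laws by `Quant.LawDec.exists_twoPoint_decomposition`, or in gate coordinates by
`Quant.RootDecGate.exists_TA_decomposition`), floor `x ≤ 1`.  For every GENUINE choice function `σ` (all `λ k (σ k) > 0`), with
`s = Σ_k lo`, `a k = hi − lo`, `g k` the term's data, ONE of:
* (β) `j + 1 ≤ s`;
* (α) a heavy giant: `x ≤ g k`, `j + 1 ≤ s + a k`;
* (γ) `DIBWith x ψ` for some `ψ` (Conjecture DIB\* `DIBStar x`, census-2's `DIBPsi x`, or a proved instance such as `DIBStar.of_le_half`)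
  AND the effective discounted credit `2j < 2s + Σ_k [a g | min(a, j − s)·max(ψ g, 0)]` — the DIB hypothesis travels INSIDE the
  disjunct, so the menu is unconditional whenever γ is not invoked;
* (γ‴) `1/2 ≤ x` and a finset `S ⊇` sub-floor blobs with the GAP check at `2(j − s) + 1 − Σ_{k ∉ S} a k` (lead g16's
  `IndepBlob.tail_ge_of_gapCert`);
* (γ⁗) `1/2 ≤ x` and a companion-cloud certificate (lead g16's `IndepBlob.tail_ge_of_companion_cloud`);
* (γ⁗₁) `1/2 ≤ x` and a one-light companion certificate with the odds condition (`IndepBlob.tail_ge_of_companion_oneLight`);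
* (match) `1/2 ≤ x < 1` and lead g16's MATCHING ROW: a finset `L` matched injectively to heavy companions outside `L` of at least the
  matched sizes with the odds condition, all blobs outside `L` heavy, `2j + 1 ≤ Σ a + 2s` (`IndepBlob.tail_ge_of_matched_companions`);
* (μ) p1 g11's graded merge: every sub-floor blob mergeable at layer `j − s` and the TRUE mean budget `2j < 2s + Σ a g`
  (`RootDec.term_ge_of_gradedMerge`);
* (ε) Cantelli: `s ≤ j`, `j − s < m = Σ a g` and `x ≤ 1 − V/(V + (m − (j − s))²)`, `V = Σ a² g(1 − g)` (`RootDec.term_ge_of_cantelli`).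
Then `x ≤ RTAIL[M, μ, j]`.

[this work]; rules: typer g17 (β/α/γ/ε sockets), lead g16 (gap calculus, companions, matching), p1 g11 (graded merge), census-2 g49/g50 (architecture);
the gluing rows served [cite: KozmaNitzan2024, Conjecture 3 (p. 15)]; product weights [cite: Grimmett1999, §1.3 p. 10].
-/

namespace Summit.CriticalPhenomena.PercolationContinuityZ3.Theorems

namespace Quant

namespace RootDec

open Finset

variable {κ : Type} [Fintype κ] [DecidableEq κ]

/-- configurations of structure counts bounded by `M` (as in `…QuantRootReduction`) -/
local notation3 "cfg[" M "]" => Fintype.piFinset (fun k : κ => Finset.range ((M : κ → ℕ) k + 1))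

/-- the ROOT tail (as in `…QuantRootReduction`) -/
local notation3 "RTAIL[" M ", " μ ", " j "]" =>
  ∑ c ∈ cfg[M], (∏ k, (μ : κ → ℕ → ℝ) k ((c : κ → ℕ) k)) * (if (j : ℕ) + 1 ≤ ∑ k, (c : κ → ℕ) k then (1 : ℝ) else 0)

/-- the two-point law `{lo, hi; g}` (as in `…QuantRootReduction`) -/
local notation3 "TP[" lo ", " hi ", " g ", " h "]" =>
  (g : ℝ) * (if (h : ℕ) = (hi : ℕ) then (1 : ℝ) else 0) + (1 - (g : ℝ)) * (if (h : ℕ) = (lo : ℕ) then (1 : ℝ) else 0)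

/-- the restricted tail `P(N_S ≥ t)` of the blobs of `S` alone (the shape used by `…QuantIndepBlobGapCalculus`) -/
local notation3 "TLS[" g ", " a ", " S ", " t "]" =>
  ∑ u ∈ (S : Finset κ).powerset, (∏ i ∈ (S : Finset κ), (if i ∈ u then (g : κ → ℝ) i else 1 - (g : κ → ℝ) i)) *
    (if (t : ℕ) ≤ ∑ i ∈ u, (a : κ → ℕ) i then (1 : ℝ) else 0)

/-- **THE CERTIFICATE MENU OF THE ROOT REDUCTION** (see the module docstring for the nine rules).  [this work] -/
theorem rtail_ge_of_certMenu {ρ : Type*} [Fintype ρ] [DecidableEq ρ] (M : κ → ℕ) (μ : κ → ℕ → ℝ) (lam : κ → ρ → ℝ)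
    (lo hi : κ → ρ → ℕ) (g : κ → ρ → ℝ) (j : ℕ) (x : ℝ) (hx1 : x ≤ 1)
    (hlam0 : ∀ k r, 0 ≤ lam k r) (hlam1 : ∀ k, ∑ r, lam k r = 1)
    (hμ : ∀ k h, μ k h = ∑ r, lam k r * TP[lo k r, hi k r, g k r, h])
    (hlohi : ∀ k r, lo k r ≤ hi k r) (hhi : ∀ k r, hi k r ≤ M k)
    (hg : ∀ k r, 0 < lam k r → 0 ≤ g k r ∧ g k r ≤ 1)
    (hcert : ∀ σ : κ → ρ, (∀ k, 0 < lam k (σ k)) →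
      -- (β) sure mass
      (j + 1 ≤ ∑ k, lo k (σ k)) ∨
      -- (α) a heavy giant
      (∃ k, x ≤ g k (σ k) ∧ j + 1 ≤ (∑ k', lo k' (σ k')) + (hi k (σ k) - lo k (σ k))) ∨
      -- (γ) a discounted-independent-blob row and the effective discounted credit
      (∃ ψ : ℝ → ℝ, IndepBlob.DIBWith x ψ ∧
        (2 * j : ℝ) < 2 * ((∑ k, lo k (σ k) : ℕ) : ℝ) + ∑ k, (if x ≤ g k (σ k)
          then ((hi k (σ k) - lo k (σ k) : ℕ) : ℝ) * g k (σ k)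
          else ((min (hi k (σ k) - lo k (σ k)) (j - ∑ k', lo k' (σ k')) : ℕ) : ℝ) * max (ψ (g k (σ k))) 0)) ∨
      -- (γ‴) the gap check on a finset containing the sub-floor blobs
      (1 / 2 ≤ x ∧ ∃ S : Finset κ, (∀ k, g k (σ k) < x → k ∈ S) ∧
        ∀ y v : ℕ, y ≤ v →
          y + v + (∑ k ∈ Sᶜ, (hi k (σ k) - lo k (σ k))) + 2 * (∑ k, lo k (σ k)) ≤ 2 * j + 2 →
          x ≤ x * TLS[(fun k => g k (σ k)), (fun k => hi k (σ k) - lo k (σ k)), S, y] +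
              (1 - x) * TLS[(fun k => g k (σ k)), (fun k => hi k (σ k) - lo k (σ k)), S, v]) ∨
      -- (γ⁗) one heavy companion of a cloud
      (1 / 2 ≤ x ∧ ∃ (L : Finset κ) (k₀ : κ), k₀ ∉ L ∧ x ≤ g k₀ (σ k₀) ∧ (∀ k, k ∉ insert k₀ L → x ≤ g k (σ k)) ∧
        2 * j + 1 ≤ (∑ k ∈ (insert k₀ L)ᶜ, (hi k (σ k) - lo k (σ k))) + 2 * (hi k₀ (σ k₀) - lo k₀ (σ k₀)) +
          2 * (∑ k, lo k (σ k)) ∧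
        ∀ y w : ℕ, 1 ≤ y → 1 ≤ w →
          y + w + (∑ k ∈ (insert k₀ L)ᶜ, (hi k (σ k) - lo k (σ k))) + (hi k₀ (σ k₀) - lo k₀ (σ k₀)) +
            2 * (∑ k, lo k (σ k)) = 2 * j + 2 →
          x * (1 - g k₀ (σ k₀)) * (1 - TLS[(fun k => g k (σ k)), (fun k => hi k (σ k) - lo k (σ k)), L, y]) ≤
            (1 - x) * g k₀ (σ k₀) * TLS[(fun k => g k (σ k)), (fun k => hi k (σ k) - lo k (σ k)), L, w]) ∨
      -- (γ⁗₁) one light blob, one companion, odds condition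
      (1 / 2 ≤ x ∧ ∃ ℓ k₀ : κ, k₀ ≠ ℓ ∧ x ≤ g k₀ (σ k₀) ∧ (∀ k, k ≠ k₀ → k ≠ ℓ → x ≤ g k (σ k)) ∧
        2 * j + 1 ≤ (∑ k ∈ ({k₀, ℓ} : Finset κ)ᶜ, (hi k (σ k) - lo k (σ k))) + 2 * (hi k₀ (σ k₀) - lo k₀ (σ k₀)) +
          2 * (∑ k, lo k (σ k)) ∧
        2 * j + 1 ≤ (∑ k ∈ ({k₀, ℓ} : Finset κ)ᶜ, (hi k (σ k) - lo k (σ k))) + (hi k₀ (σ k₀) - lo k₀ (σ k₀)) +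
          (hi ℓ (σ ℓ) - lo ℓ (σ ℓ)) + 2 * (∑ k, lo k (σ k)) ∧
        x * (1 - g k₀ (σ k₀)) * (1 - g ℓ (σ ℓ)) ≤ (1 - x) * g k₀ (σ k₀) * g ℓ (σ ℓ)) ∨
      -- (match) every blob of `L` matched to its own heavy companion outside `L`
      (1 / 2 ≤ x ∧ x < 1 ∧ ∃ (L : Finset κ) (c : κ → κ), (∀ ℓ ∈ L, c ℓ ∉ L) ∧ (∀ ℓ₁ ∈ L, ∀ ℓ₂ ∈ L, c ℓ₁ = c ℓ₂ → ℓ₁ = ℓ₂) ∧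
        (∀ ℓ ∈ L, x ≤ g (c ℓ) (σ (c ℓ))) ∧ (∀ ℓ ∈ L, hi ℓ (σ ℓ) - lo ℓ (σ ℓ) ≤ hi (c ℓ) (σ (c ℓ)) - lo (c ℓ) (σ (c ℓ))) ∧
        (∀ ℓ ∈ L, x * (1 - g (c ℓ) (σ (c ℓ))) * (1 - g ℓ (σ ℓ)) ≤ (1 - x) * g (c ℓ) (σ (c ℓ)) * g ℓ (σ ℓ)) ∧
        (∀ k, k ∉ L → x ≤ g k (σ k)) ∧
        2 * j + 1 ≤ (∑ k, (hi k (σ k) - lo k (σ k))) + 2 * (∑ k, lo k (σ k))) ∨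
      -- (μ) graded merge of the sub-floor blobs, true-mean budget
      ((∀ k, g k (σ k) < x → (j : ℝ) ≤ (∑ k', lo k' (σ k') : ℕ) + g k (σ k) *
          ∑ i ∈ (Finset.univ : Finset κ).filter (fun i => g k (σ k) < g i (σ i)), ((hi i (σ i) - lo i (σ i) : ℕ) : ℝ)) ∧
        (∀ k, g k (σ k) < x → ∃ i, g k (σ k) < g i (σ i) ∧ 0 < hi i (σ i) - lo i (σ i)) ∧
        (2 * j : ℝ) < 2 * ((∑ k, lo k (σ k) : ℕ) : ℝ) + ∑ k, ((hi k (σ k) - lo k (σ k) : ℕ) : ℝ) * g k (σ k)) ∨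
      -- (ε) Cantelli with the term's mean and variance
      ((∑ k, lo k (σ k)) ≤ j ∧
        ((j - ∑ k, lo k (σ k) : ℕ) : ℝ) < ∑ k, ((hi k (σ k) - lo k (σ k) : ℕ) : ℝ) * g k (σ k) ∧
        x ≤ 1 - (∑ k, ((hi k (σ k) - lo k (σ k) : ℕ) : ℝ) ^ 2 * g k (σ k) * (1 - g k (σ k))) /
          ((∑ k, ((hi k (σ k) - lo k (σ k) : ℕ) : ℝ) ^ 2 * g k (σ k) * (1 - g k (σ k))) +
            ((∑ k, ((hi k (σ k) - lo k (σ k) : ℕ) : ℝ) * g k (σ k)) - ((j - ∑ k, lo k (σ k) : ℕ) : ℝ)) ^ 2))) :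
    x ≤ RTAIL[M, μ, j] := by
  refine rtail_ge_of_terms M μ lam lo hi g hlam0 hlam1 hμ hlohi hhi j x fun σ hpos => ?_
  have hgσ : ∀ k, 0 ≤ g k (σ k) ∧ g k (σ k) ≤ 1 := fun k => hg k (σ k) (hpos k)
  rcases hcert σ hpos with hβ | ⟨k, hxk, hk⟩ | ⟨ψ, hD, hγ⟩ | ⟨hx, S, hSl, hS⟩ | ⟨hx, L, k₀, hk₀, hk₀x, hheavy, hbig, hcloud⟩ |
      ⟨hx, ℓ, k₀, hne, hk₀x, hheavy, hbig, hbℓ, hodds⟩ | ⟨hx, hx1', L, c, hcL, hcinj, hcx, hsize, hodds, hheavy, htot⟩ |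
      ⟨hM, hM0, hbudget⟩ | ⟨hsj, hjm, hxε⟩
  · rw [term_eq_one_of_sure _ _ _ j hβ]; exact hx1
  · exact hxk.trans (gate_le_term_of_giant _ _ _ j hgσ k hk)
  · exact term_ge_of_dibWith_capped hD _ _ _ j hx1 hgσ hγ
  · exact term_ge_of_gapCert' _ _ _ j x hx hx1 hgσ S hSl hS
  · exact term_ge_of_companionCloud _ _ _ j x hx hx1 hgσ L k₀ hk₀ hk₀x hheavy hbig hcloud
  · exact term_ge_of_companionOneLight _ _ _ j x hx hx1 hgσ ℓ k₀ hne hk₀x hheavy hbig hbℓ hodds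
  · exact term_ge_of_matchedCompanions _ _ _ j x hx hx1' hgσ L c hcL hcinj hcx hsize hodds hheavy htot
  · exact term_ge_of_gradedMerge _ _ _ j x hx1 hgσ hM hM0 hbudget
  · exact hxε.trans (term_ge_of_cantelli _ _ _ j hgσ hsj hjm)

end RootDec

end Quant

end Summit.CriticalPhenomena.PercolationContinuityZ3.Theorems
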